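import Summits.QuantumFields.YangMills.Theorems.BalabanUVNodesN22KernelLimitOfSoftMajorants
import Summits.QuantumFields.YangMills.Theorems.BalabanUVNodesN22WindowOfLocalizedSumAtSlots

/-!
# NODE N22 (NE9) — THE (1.21)-EXISTENCE LETTER `PolLimitsExist` OF THE (1.7) LOCALIZED SUM FROM W1's ACTIVITY-LEVEL VALUE SLOT, the p. 282 TAILS
# and ONE displayed law: APPROXIMATE CROSS-VOLUME STABILITY of the small-domain partial sums («this limit exists by the localized representation (1.7)», [I] p. 264)

Cell `pub-ymgap`, Track A (HUMAN RULING D-0062), WIDTH SEAT `dag-n22-w3` g3 on node n22 = NE9; `--kind proof --supports stmt-QuantumFields-20544 --as helper` (K3⁷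
`SpineGivenEndpointR13SepCoPH`, skeleton v5 941dddb108cbaacf), COUNT-NEUTRAL.  Second file of CLAIM-2 of this seat (pub-ymgap INBOX l.28776; dag-lead DEDUP-380 (1) l.28826 «both paths free, GO»), over the schema file
`…N22KernelLimitOfSoftMajorants` (§0–§3 there: `exp_threshold_split`, `abs_polScalar_le_of_holomorphic_weighted`, `polLimitExists_sum_of_approxStable_tail`, `exists_tail_le_geometric_of_softMajorant`):
the EXISTENCE HALF of the row-n22 lever, in this seat's own lane (g2 chain `…N22AtU3OfKernelsLimitExistence` p595960 → `…N22KernelLimitOfLocalTerms` p597055).  The NE9∕(5.10) half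
(«(t8)»: W1-19b's `WindowedNE9`∕`WindowedDecay` letters from the activity slots) is dag-n22-w2 g3's ∕ dag-n22-c g12's and is NOT touched here; after it, the one N22-side letter the K3⁷
pin face still DISPLAYS is W1-19b's (1.21)-existence `PolLimitsExistOfRecord₁₃ F N θ` — THIS file reduces it to W1's ACTIVITY-LEVEL value slot + the complexified reading + the p. 282
tails + ONE displayed structural law (S≈).

WHY (print).  [I] p. 264: «Now we take a limit of these functions as T^{(j+1)} ↗ Z^d. This limit exists by the localized representation (1.7)» — the terms of the (1.7) sum whose domains
do not feel the volume converge (they are local functionals of a background which converges near the window), and the volume-feeling ones are exponentially few ((1.18) + the tree-length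
resummation, uniform in the volume).  dag-n22-w3 g2 typed this as a schema with EXACT stability of the small-domain partial sums (`polLimitExists_sum_of_stable_tail`, p597055) — the
HARD-road reading.  On the SOFT road of record (dag-n22-w2's located reason, INBOX l.26814: the probe enters through the minimizer `U_{k+1}(exp iB)`, non-locally, with the tails of
[I] p. 282) exact cross-volume equality is not available; what survives is APPROXIMATE stability with a geometric error.  So:

* §1 ★★★ `polLimitsExist_localizedSum_of_activitySlots` — W1-19b's letter `PolLimitsExist F (localizedSum F S emb) ρ bV W` from, uniformly in `(K, k)`: W1's value slot `Bound238` on prefix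
  sets `Wk K k ∋ (g_0,…,g_k)` with Road-1 numerals; per-term complexified probe readings `Φ K k X` on open `U ⊇ ball 0 r` through real-linear `ιc` (chart clause `Φ(ιc B) = emb K k (exp ρB)`,
  space clause, activity holomorphy `z ↦ H(Z; hist; Φ z)` on `U`); site weights with the p. 282 tails `w ≤ B₃e^{−δ₀dist(cast t, X)}`; `M = L^{m′}`; and (S≈).  (C²) of every term chart and the
  per-term value bounds are ENGINE OUTPUT (dag-n22-c J30-v1.1 `differentiableOn_and_norm_clusterStepE_comp_le_of_activityHol` = S25's parametric Kotecký–Preiss engine; J28's Cauchy bound);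
  the volume-feeling tails are geometric by `exists_tail_le_geometric_of_softMajorant` and `polLimitExists_sum_of_approxStable_tail` concludes (both in `…OfSoftMajorants`).
* §2 ★★★ `polLimitsExistOfRecord₁₃_of_activitySlots` — the record edition under W1-20's law `Localizes17OfRecord₁₃ F N θ S emb` (W1-19b `polLimitsExistOfRecord₁₃_iff_of_localizes`): the
  `hlim` slot of this seat's g2 pin faces and the `hL` slot of dag-n27-w1's letters-level composer `n22At_kernels_of_letters_guarded` &c.  LOCATED.
* §3 A6 (director-ym №189): `polLimitsExist_localizedSum_of_activitySlots_fires_zeroTower` — every hypothesis of §1 inhabited AT ONCE by the ZERO TOWER (no terms) at the zero chart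
  `ρ = 0`; a declared DEGENERATE model witness (joint satisfiability of the binder shapes only).

CONSUMES BY NAME (nothing re-declared): dag-n22-c J28 `contDiffAt_two_of_holomorphic` ∕ `abs_polTensor_le_of_holomorphic` (p596444), J30-v1.1
`differentiableOn_and_norm_clusterStepE_comp_le_of_activityHol` (p602155), J27 `polScalar_finset_sum` (p594958); dag-n22-w2 `softBound_of_weighted` ∕ `eventually_le_of_softSum_domSys`
(p599486); this seat's g2 `polLimitExists_of_eventually_geometric_increments` (p595960); node00-def-W1 W1-19b `PolLimitsExist` ∕ `PolLimitsExistOfRecord₁₃` ∕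
`polLimitsExistOfRecord₁₃_iff_of_localizes` (p595370), W1-20 `localizedSum` ∕ `Localizes17OfRecord₁₃` (p592608), W1 `ClusterStep.{H, E, Bound238}`; def-B `polScalar` ∕ `PolLimitExists`;
dag-n23-b `polScalar_zeroChart`; Literature `B12Decay510Torus.{distCT, nearT}`, `B12TreeDecay.{K₀, kappa₀}`, `TreeLengthTorus.torusTreeLen`.

HONEST FRAMING (binding).  Count-neutral COMPOSITION + one elementary thresholded resummation; THEOREMS ONLY (0 def, 0 sorry, standard axioms).  Every estimate of Bałaban's STAYS A
DISPLAYED HYPOTHESIS with its owner: W1's (2.38) value slot at the towers of record (N10's Lemma 3 T-row ∕ NODE A), activity holomorphy through the complexified minimizer reading `Φ` and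
`Φ` itself ([I] p. 264, [II] p. 15 — NODE A), the p. 282 site-weight tails (NODE A), the approximate cross-volume stability (S≈) of the small-domain terms (NODE A ∕ def-W1: the
thermodynamic convergence of the RG terms near the window — the CONTENT of «this limit exists by (1.7)»), W1-20's law `Localizes17OfRecord₁₃` (NODE A ∕ N10), Road-1 numerals.  (1.21)'s
existence for the terms OF RECORD is NOT proved; nothing of Bałaban's is constructed; no inhabitant at the datum of record; N22 NOT discharged; K3⁷ OPEN, NOT claimed; no count claim (the
chair's single count line is the only count); one finite 𝕋⁴ programme at fixed ε — R4 closes the CONDITIONAL rung `BalabanLadder.UV` only; NOTHING about the continuum limit, ℝ⁴, infinite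
volume, OS axioms, a mass gap or the Clay problem is proved or claimed by any of this.  No decl carries a cite tag (Summit side); TYPES only: [I] = [Balaban1987RG1] (1.7) p. 261, (1.18)
p. 263, (1.20)–(1.21) p. 264, p. 282, (4.35)–(4.37) pp. 290–291, (5.10) p. 293; [II] = [Balaban1988RG2Cluster] (2.13)–(2.14) pp. 14–15, Lemma 3 (2.38) p. 20.
-/

noncomputable section

open Filter Topology Metric Set
open scoped BigOperators

namespace YMDAG.N22.AtKernels

open Literature.MathematicalPhysics.QuantumFieldTheory.Balaban1983to89
open Literature.MathematicalPhysics.QuantumFieldTheory.Balaban1983to89.T4Continuum (T4Family)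
open Literature.MathematicalPhysics.QuantumFieldTheory.Balaban1983to89.T4OutputRate (Window)
open Literature.MathematicalPhysics.QuantumFieldTheory.Balaban1983to89.B12PolarizationTensor120 (polTensor polComp expChart)
open Literature.MathematicalPhysics.QuantumFieldTheory.Balaban1983to89.Node00 (polScalar polWindow siteOfInt PolLimitExists Stage13Params MatA)
open Literature.MathematicalPhysics.QuantumFieldTheory.Balaban1983to89.Node00.Sect2 (domCount domSys CPair)
open Literature.MathematicalPhysics.QuantumFieldTheory.Balaban1983to89.Node00.W1 (ClusterTower ClusterStep)
open Literature.MathematicalPhysics.QuantumFieldTheory.Balaban1983to89.Node00.LocalizedSum17 (localizedSum ReadingMaps Localizes17OfRecord₁₃)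
open Literature.MathematicalPhysics.QuantumFieldTheory.Balaban1983to89.Node00.U3OfKernels (histPrefix)
open Literature.MathematicalPhysics.QuantumFieldTheory.Balaban1983to89.Node00.U3KernelLetters (PolLimitsExist PolLimitsExistOfRecord₁₃ polLimitsExistOfRecord₁₃_iff_of_localizes)
open Literature.MathematicalPhysics.QuantumFieldTheory.Balaban1983to89.B12Decay510 (delta1)
open Literature.MathematicalPhysics.QuantumFieldTheory.Balaban1983to89.B12Decay510Window (K₁)
open Literature.MathematicalPhysics.QuantumFieldTheory.Balaban1983to89.B12Decay510Torus (distCT nearT distCT_nonneg)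
open Literature.MathematicalPhysics.QuantumFieldTheory.Balaban1983to89.B12TreeDecay (K₀ kappa₀ K₀_pos kappa₀_nonneg)
open Literature.MathematicalPhysics.QuantumFieldTheory.Balaban1983to89.TreeLengthTorus (TPt torusTreeLen torusTreeLen_nonneg)
open YMDAG.N22.WindowOfLocalTerms (contDiffAt_two_of_holomorphic abs_polTensor_le_of_holomorphic
  differentiableOn_and_norm_clusterStepE_comp_le_of_activityHol)
open YMDAG.N22.WindowSoftTwoPoint (eventually_le_of_softSum_domSys)

/-! ## §1 AT W1-20's LOCALIZED SUM: W1-19b's letter `PolLimitsExist` from W1's ACTIVITY-LEVEL VALUE SLOT, the complexified reading, the p. 282 tails and (S≈) -/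

section Reading

variable {𝔄 : Type*} [NormedRing 𝔄] [NormedAlgebra ℝ 𝔄] {𝔸 : Type*}
variable {V : Type*} [NormedAddCommGroup V] [NormedSpace ℝ V] {ι : Type*} [Fintype ι]
variable (F : T4Family)

open YMDAG.N22.WindowSoftTwoPoint (softBound_of_weighted) in
open Classical in
/-- ★★★ **THE (1.21)-EXISTENCE LETTER OF THE (1.7) LOCALIZED SUM FROM W1's ACTIVITY-LEVEL VALUE SLOT + (S≈).**  For node00-def-W1's term family `localizedSum F S emb` (towers `S` over
def-T's catalogue with cubes of side `M = L^{m′}`, reading maps `emb`), a probe `ρ`, a basis `bV` and a window `W` — IF, uniformly in `(K, k)`: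
(slot) W1's DISPLAYED (2.38) value bound `Bound238 ((S K) k) (Wk K k) (sp K k) A R` on prefix sets `Wk K k ∋ (g_0,…,g_k)`, `g ∈ W`, with Road-1 numerals `A ≥ 0`, `0 ≤ r₁`, `0 < κ ≤ r₁`,
`κ₀(64,8) ≤ κ∕4`, `r₁ + 128 log 162 + 2 ≤ R`, `A e^{5r₁+1}K₀(64,8)·9·64 ≤ 1`;
(reading) per term a complexified probe reading `Φ K k X` on an open `U K k X ⊇ ball 0 r` through a real-linear `ιc K k X`, extending the exponential chart (`Φ (ιc B) = emb K k (exp ρB)`),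
mapping `U` into the admissible spaces of the polymers inside `X`, every activity `z ↦ H(Z; hist; Φ z)`, `Z ⊆ X`, `hist ∈ Wk K k`, holomorphic on `U` ([I] p. 264 ∕ [II] p. 15: NODE A);
(tails) site weights `‖ιc K k X e_{l,t,c}‖ ≤ w K k X t ≤ B₃ e^{−δ₀ dist(cast t, X)}` ([I] p. 282), `B₃ ≥ 0`, `δ₀ > 0`;
(S≈) APPROXIMATE CROSS-VOLUME STABILITY: for a «small∕near» class `lo k K` of domains whose complement feels the volume (`¬ lo ⇒ K ≤ d_{k+1}(X) ∨ K ≤ dist(cast site 0, X)`), the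
partial sums over the small domains of the per-term scalar kernels at the window sites of the tori `K`, `K + 1` are `C r₀^K`-close from a threshold on, `0 ≤ r₀ < 1` (the thermodynamic
convergence near the window of the terms NOT feeling the volume — the content of [I] p. 264 «this limit exists by the localized representation (1.7)»; NODE A ∕ def-W1's, DISPLAYED) —
THEN W1-19b's existence letter holds: `PolLimitsExist F (localizedSum F S emb) ρ bV W` (def-B's `PolLimitExists` at every history of the window and every level).
Composition: (C²) of every term chart and the per-term soft VALUE bounds are ENGINE OUTPUT (J30-v1.1 `differentiableOn_and_norm_clusterStepE_comp_le_of_activityHol` = S25's parametric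
Kotecký–Preiss engine, J28 `contDiffAt_two_of_holomorphic` ∕ `abs_polTensor_le_of_holomorphic`), the volume-feeling tails are geometric by `exists_tail_le_geometric_of_softMajorant`, and
`polLimitExists_sum_of_approxStable_tail` concludes (both in this seat's `…N22KernelLimitOfSoftMajorants`). -/
theorem polLimitsExist_localizedSum_of_activitySlots (m' : ℕ) (M : ℕ) [NeZero M] (hM : M = F.L ^ m')
    (S : (K : ℕ) → ClusterTower (F.P K) 𝔸 M) (emb : ReadingMaps F 𝔄 𝔸) (ρ : V →L[ℝ] 𝔄) (bV : Module.Basis ι ℝ V) (W : Set (ℕ → ℝ))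
    (Wk : (K k : ℕ) → Set (Fin (k + 1) → ℝ)) (hWk : ∀ g ∈ W, ∀ K k, histPrefix g k ∈ Wk K k)
    (sp : (K k : ℕ) → (domSys (F.P K) M (k + 1)).Dom → Set (CPair (F.P K) 𝔸)) {A R r₁ κ B₃ δ₀ r r₀ : ℝ}
    (hA : 0 ≤ A) (hr₁ : 0 ≤ r₁) (hκ0 : 0 < κ) (hκ : κ ≤ r₁) (hκ4 : kappa₀ (4 * 2 ^ 4) (2 * 4) ≤ κ / 2 / 2) (hrate : r₁ + 2 * (64 * Real.log 162) + 2 ≤ R)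
    (hsmall : A * Real.exp (5 * r₁ + 1) * K₀ 64 8 * 9 * 64 ≤ 1) (hB₃ : 0 ≤ B₃) (hδ₀ : 0 < δ₀) (hr : 0 < r)
    (h238 : ∀ K k, ((S K) k).Bound238 (Wk K k) (sp K k) A R)
    (Ec : ℕ → ℕ → Type*) [∀ K k, NormedAddCommGroup (Ec K k)] [∀ K k, NormedSpace ℂ (Ec K k)]
    (ιc : (K k : ℕ) → (domSys (F.P K) M (k + 1)).Dom → ((Fin (F.P K).d → Site (F.P K) (k + 1) → V) →L[ℝ] Ec K k))
    (Φ : (K k : ℕ) → (domSys (F.P K) M (k + 1)).Dom → Ec K k → CPair (F.P K) 𝔸)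
    (U : (K k : ℕ) → (domSys (F.P K) M (k + 1)).Dom → Set (Ec K k)) (hU : ∀ K k X, IsOpen (U K k X)) (hrU : ∀ K k X, ball (0 : Ec K k) r ⊆ U K k X)
    (hHhol : ∀ K k, ∀ hist ∈ Wk K k, ∀ (X Z : (domSys (F.P K) M (k + 1)).Dom), Z.1 ⊆ X.1 →
      DifferentiableOn ℂ (fun z => ((S K) k).H hist (Φ K k X z) Z) (U K k X))
    (hΦemb : ∀ K k X (B : Fin (F.P K).d → Site (F.P K) (k + 1) → V), Φ K k X (ιc K k X B) = emb K k (fun l t => NormedSpace.exp (ρ (B l t))))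
    (hΦsp : ∀ K k X, ∀ z ∈ U K k X, ∀ Z : (domSys (F.P K) M (k + 1)).Dom, Z.1 ⊆ X.1 → Φ K k X z ∈ sp K k Z)
    (w : (K k : ℕ) → (domSys (F.P K) M (k + 1)).Dom → Site (F.P K) (k + 1) → ℝ) (hw₀ : ∀ K k X t, 0 ≤ w K k X t)
    (hw : ∀ K k X (l : Fin (F.P K).d) (t : Site (F.P K) (k + 1)) (c : ι), ‖ιc K k X (Pi.single l (Pi.single t (bV c)))‖ ≤ w K k X t)
    (hwB : ∀ K k (X : (domSys (F.P K) M (k + 1)).Dom) (t : Site (F.P K) (k + 1)),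
      w K k X t ≤ B₃ * Real.exp (-δ₀ * distCT (domCount (F.P K) M (k + 1)) M (fun i => (ZMod.cast (t i) : ZMod (domCount (F.P K) M (k + 1) * M)))
        (nearT (M := M) (fun i => (ZMod.cast (t i) : ZMod (domCount (F.P K) M (k + 1) * M))) X)))
    (lo : (k K : ℕ) → (domSys (F.P K) M (k + 1)).Dom → Prop) [∀ k K, DecidablePred (lo k K)]
    (hlo : ∀ (k K : ℕ) (X : (domSys (F.P K) M (k + 1)).Dom), ¬ lo k K X →
      let e : Site (F.P K) (k + 1) → TPt 4 (domCount (F.P K) M (k + 1) * M) := fun x i => (ZMod.cast (x i) : ZMod (domCount (F.P K) M (k + 1) * M))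
      (K : ℝ) ≤ torusTreeLen X.1 ∨ (K : ℝ) ≤ distCT (domCount (F.P K) M (k + 1)) M (e (siteOfInt F K (k + 1) 0)) (nearT (M := M) (e (siteOfInt F K (k + 1) 0)) X))
    (hr₀ : r₀ < 1) (hr₀' : 0 ≤ r₀)
    (hS : ∀ g ∈ W, ∀ (k : ℕ) (μ ν : Fin 4) (z : Fin 4 → ℤ), ∃ (K₀ : ℕ) (C : ℝ), ∀ K : ℕ, K₀ ≤ K →
      |∑ X ∈ Finset.univ.filter (lo k (K + 1)), polScalar (fun U' => (((S (K + 1)) k).E (histPrefix g k) (emb (K + 1) k U') X).re) ρ bV (Fin.cast (F.P_d (K + 1)).symm μ) (siteOfInt F (K + 1) (k + 1) z) (Fin.cast (F.P_d (K + 1)).symm ν) (siteOfInt F (K + 1) (k + 1) 0) -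
        ∑ X ∈ Finset.univ.filter (lo k K), polScalar (fun U' => (((S K) k).E (histPrefix g k) (emb K k U') X).re) ρ bV (Fin.cast (F.P_d K).symm μ) (siteOfInt F K (k + 1) z) (Fin.cast (F.P_d K).symm ν) (siteOfInt F K (k + 1) 0)| ≤ C * r₀ ^ K) :
    PolLimitsExist F (localizedSum F S emb) ρ bV W := by
  intro g hg k
  -- J30-v1.1's engine: every term, read through `Φ`, is holomorphic on `U` with the (2.38)-type value bound there
  have key := fun (K : ℕ) (X : (domSys (F.P K) M (k + 1)).Dom) =>
    differentiableOn_and_norm_clusterStepE_comp_le_of_activityHol F K ((S K) k) (Wk K k) (sp K k) hA hr₁ hrate hsmall (h238 K k) (hWk g hg K k) X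
      (Φ K k X) (hU K k X) (hHhol K k _ (hWk g hg K k) X) (hΦsp K k X)
  have hι0 : ∀ (K : ℕ) (X : (domSys (F.P K) M (k + 1)).Dom), ιc K k X 0 ∈ U K k X := fun K X => by
    rw [map_zero]; exact hrU K k X (mem_ball_self hr)
  have hf : ∀ (K : ℕ) (X : (domSys (F.P K) M (k + 1)).Dom) (B : Fin (F.P K).d → Site (F.P K) (k + 1) → V),
      expChart (fun U' => (((S K) k).E (histPrefix g k) (emb K k U') X).re) ρ B = (((S K) k).E (histPrefix g k) (Φ K k X (ιc K k X B)) X).re :=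
    fun K X B => by rw [B12PolarizationTensor120.expChart_apply, hΦemb]
  -- (C²) of every term chart
  have hC2 : ∀ (K : ℕ), ∀ X ∈ (Finset.univ : Finset (domSys (F.P K) M (k + 1)).Dom),
      ContDiffAt ℝ 2 (expChart (fun U' => (((S K) k).E (histPrefix g k) (emb K k U') X).re) ρ) 0 := by
    intro K X _
    rw [show expChart (fun U' => (((S K) k).E (histPrefix g k) (emb K k U') X).re) ρ =
        fun B => ((fun z => ((S K) k).E (histPrefix g k) (Φ K k X z) X) (ιc K k X B)).re from funext (hf K X)]
    exact contDiffAt_two_of_holomorphic _ (key K X).1 (hU K k X) (ιc K k X) (hι0 K X)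
  -- per-term soft VALUE bounds (J28's Cauchy bound averaged over colours)
  have hterm : ∀ (μ ν : Fin 4) (z : Fin 4 → ℤ) (K : ℕ) (X : (domSys (F.P K) M (k + 1)).Dom),
      |polScalar (fun U' => (((S K) k).E (histPrefix g k) (emb K k U') X).re) ρ bV (Fin.cast (F.P_d K).symm μ) (siteOfInt F K (k + 1) z) (Fin.cast (F.P_d K).symm ν) (siteOfInt F K (k + 1) 0)| ≤
        16 * (Real.exp 1 * 9 * 64 * K₀ 64 8 ^ 2 * A * Real.exp (-(r₁ * torusTreeLen X.1))) / r ^ 2 *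
          (w K k X (siteOfInt F K (k + 1) z) * w K k X (siteOfInt F K (k + 1) 0)) :=
    fun μ ν z K X => abs_polScalar_le_of_holomorphic_weighted _ ρ bV (fun z => ((S K) k).E (histPrefix g k) (Φ K k X z) X) (key K X).1 (hU K k X) hr
      (hrU K k X) (fun z hz => (key K X).2 z (hrU K k X hz)) (ιc K k X) (hf K X) (w K k X) (hw₀ K k X) (hw K k X) _ _ _ _
  -- … hence soft majorants with the p. 282 tails (`softBound_of_weighted`), rate weakened `r₁ ↦ κ`
  have hM₀ : 0 ≤ Real.exp 1 * 9 * 64 * K₀ 64 8 ^ 2 := by positivity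
  have hCE : 0 ≤ 16 * (Real.exp 1 * 9 * 64 * K₀ 64 8 ^ 2) * B₃ ^ 2 / r ^ 2 := by positivity
  have hmaj : ∀ (μ ν : Fin 4) (z : Fin 4 → ℤ) (K : ℕ) (X : (domSys (F.P K) M (k + 1)).Dom),
      let e : Site (F.P K) (k + 1) → TPt 4 (domCount (F.P K) M (k + 1) * M) := fun x i => (ZMod.cast (x i) : ZMod (domCount (F.P K) M (k + 1) * M))
      |polScalar (fun U' => (((S K) k).E (histPrefix g k) (emb K k U') X).re) ρ bV (Fin.cast (F.P_d K).symm μ) (siteOfInt F K (k + 1) z) (Fin.cast (F.P_d K).symm ν) (siteOfInt F K (k + 1) 0)| ≤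
        16 * (Real.exp 1 * 9 * 64 * K₀ 64 8 ^ 2) * B₃ ^ 2 / r ^ 2 * A * Real.exp (-κ * torusTreeLen X.1) *
          Real.exp (-δ₀ * distCT (domCount (F.P K) M (k + 1)) M (e (siteOfInt F K (k + 1) z)) (nearT (M := M) (e (siteOfInt F K (k + 1) z)) X)) *
          Real.exp (-δ₀ * distCT (domCount (F.P K) M (k + 1)) M (e (siteOfInt F K (k + 1) 0)) (nearT (M := M) (e (siteOfInt F K (k + 1) 0)) X)) := by
    intro μ ν z K X e
    have hexp : Real.exp (-(r₁ * torusTreeLen X.1)) ≤ Real.exp (-κ * torusTreeLen X.1) := by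
      rw [neg_mul]; exact Real.exp_le_exp.2 (neg_le_neg (mul_le_mul_of_nonneg_right hκ (torusTreeLen_nonneg _)))
    exact softBound_of_weighted hr hM₀ hA (Real.exp_nonneg _) hB₃ (Real.exp_nonneg _) (hw₀ K k X _) (hw₀ K k X _) (hterm μ ν z K X)
      (mul_le_mul_of_nonneg_left hexp (mul_nonneg hM₀ hA)) (hwB K k X _) (hwB K k X _)
  -- the volume-feeling TAILS are geometric (`exists_tail_le_geometric_of_softMajorant`) in both volumes; the schema concludes
  have hq1 : Real.exp (-(min κ δ₀ / 2)) < 1 := Real.exp_lt_one_iff.2 (by have := lt_min hκ0 hδ₀; linarith)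
  refine polLimitExists_sum_of_approxStable_tail F (k + 1) ρ bV (fun K => (domSys (F.P K) M (k + 1)).Dom) (fun _ => Finset.univ)
    (fun K X U' => (((S K) k).E (histPrefix g k) (emb K k U') X).re) hC2 (lo k) (fun K => lo k (K + 1)) hr₀ hr₀' hq1 (Real.exp_nonneg _)
    (hS g hg k) ?_ ?_
  · intro μ ν z
    obtain ⟨N₀, C, -, hN⟩ := exists_tail_le_geometric_of_softMajorant F (k + 1) m' M hM (fun K X => |polScalar (fun U' => (((S K) k).E (histPrefix g k) (emb K k U') X).re) ρ bV (Fin.cast (F.P_d K).symm μ) (siteOfInt F K (k + 1) z) (Fin.cast (F.P_d K).symm ν) (siteOfInt F K (k + 1) 0)|)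
      (lo k) hCE hA hκ0 hδ₀ hκ4 z (hmaj μ ν z) (hlo k)
    exact ⟨N₀, C, hN⟩
  · intro μ ν z
    obtain ⟨N₀, C, hC0, hN⟩ := exists_tail_le_geometric_of_softMajorant F (k + 1) m' M hM (fun K X => |polScalar (fun U' => (((S K) k).E (histPrefix g k) (emb K k U') X).re) ρ bV (Fin.cast (F.P_d K).symm μ) (siteOfInt F K (k + 1) z) (Fin.cast (F.P_d K).symm ν) (siteOfInt F K (k + 1) 0)|)
      (lo k) hCE hA hκ0 hδ₀ hκ4 z (hmaj μ ν z) (hlo k)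
    refine ⟨N₀, C, fun K hK => (hN (K + 1) (Nat.le_succ_of_le hK)).trans ?_⟩
    exact mul_le_mul_of_nonneg_left (pow_le_pow_of_le_one (Real.exp_nonneg _) hq1.le (Nat.le_succ K)) hC0

end Reading

/-! ## §2 AT THE RECORD, Stage 13: W1-19b's `PolLimitsExistOfRecord₁₃ F N θ` under W1-20's law (probe algebra `M_N(ℂ)`, the record's β-chart, window `]0, θ.γ]^ℕ`) -/

section Record

open scoped Matrix.Norms.L2Operator

variable (F : T4Family) (N : ℕ) [NeZero N] {𝔸 : Type*} {M : ℕ} [NeZero M]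

open Classical in
/-- ★★★ **THE (1.21)-EXISTENCE LETTER OF RECORD FROM W1's ACTIVITY-LEVEL VALUE SLOT + (S≈) AT A LOCALIZING READING** (LOCATED).  For towers `S` (cube side `M = L^{m′}`) read through
`emb` which LOCALIZE the merged term family of record (W1-20's displayed law `Localizes17OfRecord₁₃ F N θ S emb` — NODE A ∕ N10's), the hypotheses of
`polLimitsExist_localizedSum_of_activitySlots` at the record's β-chart `θ.ρ8 ∕ θ.bV` on the window `]0, θ.γ]^ℕ` give W1-19b's `PolLimitsExistOfRecord₁₃ F N θ` — the `hlim` ∕ `hL` slot of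
dag-n22-w3's (1.21) passage (`n22At_rateCarriers_of_kernels_pin`, `kernelDecayOfRecord₁₃_of_windowed`) and of dag-n27-w1's letters-level composer (`n22At_kernels_of_letters_guarded` &c.).
Nothing of the record is claimed to meet the hypotheses; (1.21)'s existence for the terms OF RECORD is NOT thereby proved — it is REDUCED to «activity slot + reading + tails + (S≈) + law». -/
theorem polLimitsExistOfRecord₁₃_of_activitySlots (θ : Stage13Params F N) (m' : ℕ) (hM : M = F.L ^ m')
    (S : (K : ℕ) → ClusterTower (F.P K) 𝔸 M) (emb : ReadingMaps F (MatA N) 𝔸) (hloc : Localizes17OfRecord₁₃ F N θ S emb)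
    (Wk : (K k : ℕ) → Set (Fin (k + 1) → ℝ)) (hWk : ∀ g ∈ Window θ.γ, ∀ K k, histPrefix g k ∈ Wk K k)
    (sp : (K k : ℕ) → (domSys (F.P K) M (k + 1)).Dom → Set (CPair (F.P K) 𝔸)) {A R r₁ κ B₃ δ₀ r r₀ : ℝ}
    (hA : 0 ≤ A) (hr₁ : 0 ≤ r₁) (hκ0 : 0 < κ) (hκ : κ ≤ r₁) (hκ4 : kappa₀ (4 * 2 ^ 4) (2 * 4) ≤ κ / 2 / 2) (hrate : r₁ + 2 * (64 * Real.log 162) + 2 ≤ R)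
    (hsmall : A * Real.exp (5 * r₁ + 1) * K₀ 64 8 * 9 * 64 ≤ 1) (hB₃ : 0 ≤ B₃) (hδ₀ : 0 < δ₀) (hr : 0 < r)
    (h238 : ∀ K k, ((S K) k).Bound238 (Wk K k) (sp K k) A R)
    (Ec : ℕ → ℕ → Type*) [∀ K k, NormedAddCommGroup (Ec K k)] [∀ K k, NormedSpace ℂ (Ec K k)]
    (ιc : letI := θ.instVβ₁; letI := θ.instVβ₂; letI := θ.instιβ
      (K k : ℕ) → (domSys (F.P K) M (k + 1)).Dom → ((Fin (F.P K).d → Site (F.P K) (k + 1) → θ.Vβ) →L[ℝ] Ec K k))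
    (Φ : (K k : ℕ) → (domSys (F.P K) M (k + 1)).Dom → Ec K k → CPair (F.P K) 𝔸)
    (U : (K k : ℕ) → (domSys (F.P K) M (k + 1)).Dom → Set (Ec K k)) (hU : ∀ K k X, IsOpen (U K k X)) (hrU : ∀ K k X, ball (0 : Ec K k) r ⊆ U K k X)
    (hHhol : ∀ K k, ∀ hist ∈ Wk K k, ∀ (X Z : (domSys (F.P K) M (k + 1)).Dom), Z.1 ⊆ X.1 →
      DifferentiableOn ℂ (fun z => ((S K) k).H hist (Φ K k X z) Z) (U K k X))
    (hΦemb : letI := θ.instVβ₁; letI := θ.instVβ₂; letI := θ.instιβ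
      ∀ K k X (B : Fin (F.P K).d → Site (F.P K) (k + 1) → θ.Vβ),
        Φ K k X (ιc K k X B) = emb K k (fun l t => NormedSpace.exp (θ.ρ8 (B l t))))
    (hΦsp : ∀ K k X, ∀ z ∈ U K k X, ∀ Z : (domSys (F.P K) M (k + 1)).Dom, Z.1 ⊆ X.1 → Φ K k X z ∈ sp K k Z)
    (w : (K k : ℕ) → (domSys (F.P K) M (k + 1)).Dom → Site (F.P K) (k + 1) → ℝ) (hw₀ : ∀ K k X t, 0 ≤ w K k X t)
    (hw : letI := θ.instVβ₁; letI := θ.instVβ₂; letI := θ.instιβ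
      ∀ K k X (l : Fin (F.P K).d) (t : Site (F.P K) (k + 1)) (c : θ.ιβ), ‖ιc K k X (Pi.single l (Pi.single t (θ.bV c)))‖ ≤ w K k X t)
    (hwB : ∀ K k (X : (domSys (F.P K) M (k + 1)).Dom) (t : Site (F.P K) (k + 1)),
      w K k X t ≤ B₃ * Real.exp (-δ₀ * distCT (domCount (F.P K) M (k + 1)) M (fun i => (ZMod.cast (t i) : ZMod (domCount (F.P K) M (k + 1) * M)))
        (nearT (M := M) (fun i => (ZMod.cast (t i) : ZMod (domCount (F.P K) M (k + 1) * M))) X)))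
    (lo : (k K : ℕ) → (domSys (F.P K) M (k + 1)).Dom → Prop) [∀ k K, DecidablePred (lo k K)]
    (hlo : ∀ (k K : ℕ) (X : (domSys (F.P K) M (k + 1)).Dom), ¬ lo k K X →
      let e : Site (F.P K) (k + 1) → TPt 4 (domCount (F.P K) M (k + 1) * M) := fun x i => (ZMod.cast (x i) : ZMod (domCount (F.P K) M (k + 1) * M))
      (K : ℝ) ≤ torusTreeLen X.1 ∨ (K : ℝ) ≤ distCT (domCount (F.P K) M (k + 1)) M (e (siteOfInt F K (k + 1) 0)) (nearT (M := M) (e (siteOfInt F K (k + 1) 0)) X))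
    (hr₀ : r₀ < 1) (hr₀' : 0 ≤ r₀)
    (hS : letI := θ.instVβ₁; letI := θ.instVβ₂; letI := θ.instιβ
      ∀ g ∈ Window θ.γ, ∀ (k : ℕ) (μ ν : Fin 4) (z : Fin 4 → ℤ), ∃ (K₀ : ℕ) (C : ℝ), ∀ K : ℕ, K₀ ≤ K →
      |∑ X ∈ Finset.univ.filter (lo k (K + 1)), polScalar (fun U' => (((S (K + 1)) k).E (histPrefix g k) (emb (K + 1) k U') X).re) θ.ρ8 θ.bV (Fin.cast (F.P_d (K + 1)).symm μ) (siteOfInt F (K + 1) (k + 1) z) (Fin.cast (F.P_d (K + 1)).symm ν) (siteOfInt F (K + 1) (k + 1) 0) -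
        ∑ X ∈ Finset.univ.filter (lo k K), polScalar (fun U' => (((S K) k).E (histPrefix g k) (emb K k U') X).re) θ.ρ8 θ.bV (Fin.cast (F.P_d K).symm μ) (siteOfInt F K (k + 1) z) (Fin.cast (F.P_d K).symm ν) (siteOfInt F K (k + 1) 0)| ≤ C * r₀ ^ K) :
    PolLimitsExistOfRecord₁₃ F N θ := by
  letI := θ.instVβ₁; letI := θ.instVβ₂; letI := θ.instιβ
  exact (polLimitsExistOfRecord₁₃_iff_of_localizes F N θ S emb hloc).2
    (polLimitsExist_localizedSum_of_activitySlots F m' M hM S emb θ.ρ8 θ.bV (Window θ.γ) Wk hWk sp hA hr₁ hκ0 hκ hκ4 hrate hsmall hB₃ hδ₀ hr h238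
      Ec ιc Φ U hU hrU hHhol hΦemb hΦsp w hw₀ hw hwB lo hlo hr₀ hr₀' hS)

end Record

/-! ## §3 A6 (director-ym №189): the hypotheses of §1 are JOINTLY INHABITED — at the ZERO TOWER (no terms: activities `H = 0`) and the ZERO PROBE CHART `ρ = 0` -/

section A6

variable {𝔄 : Type*} [NormedRing 𝔄] [NormedAlgebra ℝ 𝔄] {𝔸 : Type*}
variable {V : Type*} [NormedAddCommGroup V] [NormedSpace ℝ V] {ι : Type*} [Fintype ι]
variable (F : T4Family)

/-- Numerals of the smoke test: `κ := 4κ₀(64,8) + 1 > 0` meets `κ₀(64,8) ≤ κ∕4`. -/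
theorem kappa_four_smoke : 0 < 4 * kappa₀ (4 * 2 ^ 4) (2 * 4) + 1 ∧ kappa₀ (4 * 2 ^ 4) (2 * 4) ≤ (4 * kappa₀ (4 * 2 ^ 4) (2 * 4) + 1) / 2 / 2 := by
  have h0 : 0 ≤ kappa₀ (4 * 2 ^ 4) (2 * 4) := kappa₀_nonneg (c₀ := 4 * 2 ^ 4) (by positivity) (2 * 4)
  constructor <;> linarith

open Classical in
/-- ★ **A6 — THE LETTER FIRES AT THE ZERO TOWER AND THE ZERO CHART.**  For every cube exponent `m′`, every reading maps `emb`, every basis `bV` and every window `W`, ALL hypotheses of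
`polLimitsExist_localizedSum_of_activitySlots` hold SIMULTANEOUSLY for the ZERO TOWER (the anonymous `ClusterStep` with no terms, `Idx := PUnit`, `idx := ∅`, `T := 0`, so every activity
`H(Z) = 0` and (2.38) holds with amplitude `A := 0`) at the zero probe chart `ρ := 0` (`ιc := 0`, `Φ :=` the constant reading `emb K k 1`, `U := univ`, `r := 1`, weights `w := 0`, `B₃ := 0`,
`δ₀ := 1`, `κ := r₁ := 4κ₀(64,8) + 1`, every domain «small», (S≈) with `C := 0`, `r₀ := 0` since every scalar kernel vanishes at `ρ = 0`, dag-n23-b's `polScalar_zeroChart`) — and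
the theorem YIELDS `PolLimitsExist F (localizedSum F S₀ emb) 0 bV W`.  HONEST: a DEGENERATE model witness certifying only that the thirty-odd binder shapes are jointly satisfiable and the
composition elaborates end to end; it says nothing about the towers or the chart OF RECORD (§2 is LOCATED). -/
theorem polLimitsExist_localizedSum_of_activitySlots_fires_zeroTower (m' : ℕ) [NeZero (F.L ^ m')]
    (emb : ReadingMaps F 𝔄 𝔸) (bV : Module.Basis ι ℝ V) (W : Set (ℕ → ℝ)) :
    PolLimitsExist F (localizedSum F (fun K k => (⟨PUnit, fun _ => ∅, fun _ _ _ => 0⟩ : ClusterStep (F.P K) 𝔸 (F.L ^ m') k)) emb)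
      (0 : V →L[ℝ] 𝔄) bV W := by
  have hsum : ∀ (K k : ℕ) (hist : Fin (k + 1) → ℝ) (φ : CPair (F.P K) 𝔸) (Z : (domSys (F.P K) (F.L ^ m') (k + 1)).Dom),
      (⟨PUnit, fun _ => ∅, fun _ _ _ => 0⟩ : ClusterStep (F.P K) 𝔸 (F.L ^ m') k).H hist φ Z = 0 := fun K k hist φ Z => by
    simp only [ClusterStep.H, Finset.sum_empty]
  refine polLimitsExist_localizedSum_of_activitySlots F m' (F.L ^ m') rfl _ emb 0 bV W (fun _ _ => Set.univ) (fun _ _ _ _ => Set.mem_univ _)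
    (fun _ _ _ => Set.univ) (A := 0) (R := (4 * kappa₀ (4 * 2 ^ 4) (2 * 4) + 1) + 2 * (64 * Real.log 162) + 2) (r₁ := 4 * kappa₀ (4 * 2 ^ 4) (2 * 4) + 1)
    (κ := 4 * kappa₀ (4 * 2 ^ 4) (2 * 4) + 1) (B₃ := 0) (δ₀ := 1) (r := 1) (r₀ := 0)
    le_rfl (kappa_four_smoke).1.le (kappa_four_smoke).1 le_rfl (kappa_four_smoke).2 le_rfl (by simp) le_rfl one_pos one_pos
    (fun K k g _ Z φ _ => by rw [hsum, norm_zero, zero_mul])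
    (fun _ _ => ℂ) (fun K k _ => (0 : (Fin (F.P K).d → Site (F.P K) (k + 1) → V) →L[ℝ] ℂ)) (fun K k _ _ => emb K k (fun _ _ => 1)) (fun _ _ _ => Set.univ)
    (fun _ _ _ => isOpen_univ) (fun _ _ _ => Set.subset_univ _)
    (fun K k hist _ X Z _ => by simp only [hsum]; exact differentiableOn_const 0)
    (fun K k X B => by simp only [zero_apply, NormedSpace.exp_zero])
    (fun _ _ _ _ _ _ _ => Set.mem_univ _)
    (fun _ _ _ _ => 0) (fun _ _ _ _ => le_rfl) (fun _ _ _ _ _ _ => by rw [zero_apply, norm_zero]) (fun _ _ _ _ => by rw [zero_mul])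
    (fun _ _ _ => True) (fun _ _ _ h => (h trivial).elim) zero_lt_one le_rfl
    (fun g _ k μ ν z => ⟨0, 0, fun K _ => by simp [Node00.Record8Inhabited.polScalar_zeroChart]⟩)

end A6

end YMDAG.N22.AtKernels

end
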